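import Mathlib.MeasureTheory.Integral.DominatedConvergence
import Mathlib.MeasureTheory.Integral.Bochner.Basic
import Mathlib.Topology.Order.Compact
import HarnessLib

/-!
# Continuity and positivity of kernel overlaps `u ↦ ∫ φ(y) K(u, y) dρ(y)`

Topic `Literature/Analysis/OperatorTheory`; companion of `PositiveKernelTransferOperator.lean` and
`PowerIterationRatioLimit.lean`. For the transfer-operator proof of uniqueness of one-dimensional
Gibbs states one needs that the overlap `c(u) = ⟪φ, k_u⟫ = ∫ φ(y) K(u, y) dρ(y)` of the strictly
positive top eigenvector `φ` with the kernel sections is CONTINUOUS in the boundary spin `u` (for a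
jointly bounded kernel continuous in `u`) and STRICTLY POSITIVE, hence bounded below by some `δ > 0`
on every compact set of boundary spins — the sets on which `exists_forall_abs_ratio_sub_lt` gives
uniform convergence. Mathlib only (dominated convergence `continuous_of_dominated`,
`integral_pos_iff_support_of_nonneg_ae`, `IsCompact.exists_isMinOn`); everything PROVED, no definitions.

* `continuous_integral_mul_kernel` — `u ↦ ∫ φ(y) K(u,y) dρ(y)` is continuous for `φ ∈ L¹(ρ)`,
  `|K| ≤ C`, `K(·, y)` continuous;
* `integral_mul_kernel_pos` — it is `> 0` when `φ ≥ 0` a.e., `φ ≠ 0` in `L¹` and `K > 0`;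
* `exists_pos_forall_le_integral_mul_kernel` — on a compact set of `u` it is bounded below by some
  `δ > 0`. [folklore]
-/

noncomputable section

open MeasureTheory Filter Topology Set Function

namespace Literature.Analysis.OperatorTheory

variable {Y : Type*} [TopologicalSpace Y] [MeasurableSpace Y] {ρ : Measure Y}
  {K : Y → Y → ℝ} {C : ℝ} {φ : Y → ℝ}

/-- **Continuity of kernel overlaps** (dominated convergence): for `φ ∈ L¹(ρ)`, a kernel bounded by
`C`, measurable in `y` and continuous in `u`, the map `u ↦ ∫ φ(y) K(u, y) dρ(y)` is continuous.
[folklore] -/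
theorem continuous_integral_mul_kernel [FirstCountableTopology Y] (hKc : ∀ y, Continuous fun u => K u y)
    (hKm : ∀ u, AEStronglyMeasurable (K u) ρ) (hC : ∀ u y, ‖K u y‖ ≤ C) (hφ : Integrable φ ρ) :
    Continuous fun u => ∫ y, φ y * K u y ∂ρ := by
  refine continuous_of_dominated (bound := fun y => C * ‖φ y‖) (fun u => hφ.1.mul (hKm u))
    (fun u => Eventually.of_forall fun y => ?_) (hφ.norm.const_mul C)
    (Eventually.of_forall fun y => continuous_const.mul (hKc y))
  calc ‖φ y * K u y‖ = ‖K u y‖ * ‖φ y‖ := by rw [norm_mul, mul_comm]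
    _ ≤ C * ‖φ y‖ := by gcongr; exact hC u y

omit [TopologicalSpace Y] in
/-- **Positivity of kernel overlaps**: for `φ ≥ 0` a.e. with `φ ≠ 0` in `L¹(ρ)` and a strictly
positive bounded kernel, `∫ φ(y) K(u, y) dρ(y) > 0` for EVERY `u`. [folklore] -/
theorem integral_mul_kernel_pos (hpos : ∀ u y, 0 < K u y) (hKm : ∀ u, AEStronglyMeasurable (K u) ρ)
    (hC : ∀ u y, ‖K u y‖ ≤ C) (hφ : Integrable φ ρ) (hφ0 : 0 ≤ᵐ[ρ] φ)
    (hφne : ¬ φ =ᵐ[ρ] 0) (u : Y) : 0 < ∫ y, φ y * K u y ∂ρ := by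
  have hint : Integrable (fun y => φ y * K u y) ρ :=
    hφ.mul_bdd (hKm u) (Eventually.of_forall fun y => hC u y)
  have hnn : 0 ≤ᵐ[ρ] fun y => φ y * K u y := by
    filter_upwards [hφ0] with y hy using mul_nonneg hy (hpos u y).le
  rw [integral_pos_iff_support_of_nonneg_ae hnn hint]
  have hs : support (fun y => φ y * K u y) = support φ := by
    ext y
    simp only [mem_support, ne_eq, mul_eq_zero, (hpos u y).ne', or_false]
  rw [hs, pos_iff_ne_zero]
  intro h0
  refine hφne ?_
  have : ∀ᵐ y ∂ρ, y ∉ support φ := measure_eq_zero_iff_ae_notMem.1 h0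
  filter_upwards [this] with y hy
  simpa [mem_support] using hy

/-- **Kernel overlaps are bounded below on compact sets of boundary spins**: under the hypotheses of
the two previous lemmas, for every compact `S` there is `δ > 0` with `δ ≤ ∫ φ(y) K(u, y) dρ(y)` for
all `u ∈ S`. [folklore] -/
theorem exists_pos_forall_le_integral_mul_kernel [FirstCountableTopology Y]
    (hKc : ∀ y, Continuous fun u => K u y)
    (hpos : ∀ u y, 0 < K u y) (hKm : ∀ u, AEStronglyMeasurable (K u) ρ) (hC : ∀ u y, ‖K u y‖ ≤ C)
    (hφ : Integrable φ ρ) (hφ0 : 0 ≤ᵐ[ρ] φ) (hφne : ¬ φ =ᵐ[ρ] 0) {S : Set Y} (hS : IsCompact S) :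
    ∃ δ : ℝ, 0 < δ ∧ ∀ u ∈ S, δ ≤ ∫ y, φ y * K u y ∂ρ := by
  rcases S.eq_empty_or_nonempty with rfl | hne
  · exact ⟨1, one_pos, fun u hu => absurd hu (notMem_empty u)⟩
  · have hcont := continuous_integral_mul_kernel hKc hKm hC hφ
    obtain ⟨u₀, hu₀, hmin⟩ := hS.exists_isMinOn hne hcont.continuousOn
    exact ⟨∫ y, φ y * K u₀ y ∂ρ, integral_mul_kernel_pos hpos hKm hC hφ hφ0 hφne u₀,
      fun u hu => hmin hu⟩

end Literature.Analysis.OperatorTheory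

end
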